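import Summits.FinalStateConjecture.FinalStateConjecture.Theses.SwallowTheDatum
import Literature.Geometry.Lorentzian.InitialDataPullback
import Literature.Geometry.Lorentzian.ConvergenceTransport
import Literature.Geometry.Lorentzian.SubdevelopmentTimelikeEntry
import Literature.Geometry.Lorentzian.SubdevelopmentCausalConvexity
import Literature.Geometry.Lorentzian.TimelikeCurveLift
import Literature.Geometry.Lorentzian.OpensCausality
import Literature.Geometry.Lorentzian.CausalityPushUp
import Literature.Geometry.Lorentzian.CausalityAchronalProofs
import Literature.Geometry.Lorentzian.CauchyHypersurfaceCausalProofs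
import Literature.Geometry.Lorentzian.CommonDevelopmentEmbedding
import HarnessLib

/-!
# Crux `SwallowTheDatum.UniversalWitnessFamily` (stmt-FinalStateConjecture-10051), line `Sketch`
# (throat-settles-too), stub `stub_exteriorTransport`

**The self-determined exterior region transports along embeddings of sub-developments.** Let `𝒟`
be a Cauchy development of the datum `D` on `X`, `Φ : N → X` a smooth open embedding with
injective differentials, `𝒦` a Cauchy development of the pulled-back datum `Φ^* D` on `N`, and
`χ : 𝒦 → 𝒟` a smooth, time-orientation preserving, isometric open embedding OVER `Φ`
(`χ ∘ ι' = ι ∘ Φ`, the conclusion shape of the route item `SubdataDevelopmentsEmbed`). Then for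
every `C ⊆ 𝒦`
`J⁺_𝒟(ι X) ∩ I⁻_𝒟(χ C) = χ (J⁺_𝒦(ι' N) ∩ I⁻_𝒦(C))`,
i.e. `exteriorOf 𝒟 (χ '' C) = χ '' exteriorOf 𝒦 C` (`stub_exteriorTransport`).

Proof (generic causal theory; only `χ(ι' N) ⊆ ι X` is used of `Φ`):

* `exists_lift_isFutureTimelikeCurveOn` — a future timelike curve of `𝒟` lying in `χ(𝒦)` lifts
  along the injective local isometry `χ` to a future timelike curve of `𝒦` (locally `χ⁻¹ ∘ γ` for a
  smooth local inverse; isometry and the converse timecone lemma; adapted from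
  `LorentzianMetric.exists_lift_isEndlessTimelikeCurve`).
* `image_chronologicalFuture_subset`, `image_chronologicalPast_subset` — `χ(I^±(S)) ⊆ I^±(χ S)`.
* `isCauchyHypersurface_restrict_range` — `ι X ∩ χ(𝒦)` is a Cauchy hypersurface of the open
  sub-spacetime `χ(𝒦)` of `𝒟`: an endless timelike curve of `χ(𝒦)` lifts to an endless timelike
  curve of `𝒦`, which meets `ι' N`, and `χ(ι' N) ⊆ ι X`; at most one crossing because `ι X` is a
  Cauchy hypersurface of `𝒟` (`IsCauchyHypersurface.eq_of_mem_of_mem_opens`).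
* `exteriorOf_image_eq` — `⊇`: `χ` carries causal/timelike curves to such. `⊆` (exterior
  ignorance): `ι X` is achronal, so NO TIMELIKE CURVE ENTERS `χ(𝒦)` FROM `J⁺(ι X) ∖ χ(𝒦)`
  (`IsAchronal.mem_opens_of_mem_chronologicalFuture`, Sbierski 2016, §3.2); the timelike curve from
  such a point `p ≪ χ c` to `χ c` stays in `χ(𝒦)` (causal convexity) and lifts, so `p = χ k`,
  `k ≪ c`; and `k ∈ J⁺_𝒦(ι' N)`, for otherwise `k ≪ ι' N`, whence `p ∈ I⁻_𝒟(ι X) ∩ J⁺_𝒟(ι X)` and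
  push-up (O'Neill's Cor. 14.1) yields two chronologically related points of the achronal `ι X`.

References: J. Sbierski, Ann. Henri Poincaré 17 (2016) 301–329, §3.2; B. O'Neill,
*Semi-Riemannian geometry* (1983), Ch. 3, pp. 90–91, Ch. 5, p. 145, Ch. 14, Cor. 14.1,
Lemma 14.29; S. W. Hawking, G. F. R. Ellis, *The large scale structure of space-time* (1973), §6.5.
-/

-- `FinalStateConjecture.FinalStateConjecture`: summit and problem share the name (intended duplication)
set_option linter.dupNamespace false

noncomputable section

open scoped Manifold ContDiff Topology
open Set Function Topology Literature.Geometry.Lorentzian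

namespace Summit.FinalStateConjecture.FinalStateConjecture.Theorems.SwallowTheDatum.UniversalWitnessFamily

/-! ## Lifting timelike curves along an injective local isometry -/

section Lift

variable {EN : Type*} [NormedAddCommGroup EN] [NormedSpace ℝ EN] {HN : Type*} [TopologicalSpace HN]
  {IN : ModelWithCorners ℝ EN HN} {N : Type*} [TopologicalSpace N] [ChartedSpace HN N]
  [IsManifold IN ∞ N]
  {EP : Type*} [NormedAddCommGroup EP] [NormedSpace ℝ EP] {HP : Type*} [TopologicalSpace HP]
  {IP : ModelWithCorners ℝ EP HP} {P : Type*} [TopologicalSpace P] [ChartedSpace HP P]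
  [IsManifold IP ∞ P]

/-- **Lifting future timelike curves along an injective local isometry.** Let `Φ : N → P` be an
injective `C^∞` local diffeomorphism between time-oriented Lorentzian manifolds which is an
isometric immersion preserving the time orientations, and `γ` a future timelike curve of `P` on a
nonempty parameter set `s` with `γ(s) ⊆ Φ(N)`. Then `γ|_s` lifts along `Φ` to a future timelike
curve `δ` of `N`: locally `δ = Φ⁻¹ ∘ γ` for a smooth local inverse (injectivity makes the lift
single valued), so `δ` is differentiable with `dΦ(δ') = γ'`, timelike (isometry) and
future-directed (converse timecone lemma `PreservesTimeOrientation.isFutureDirected_of_mfderiv`).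
O'Neill 1983, Ch. 3, pp. 90–91 (local isometries) and Ch. 5, p. 145 (timecones); the step
*"`γ|_J` can be considered as a timelike curve in `M`"* of Sbierski 2016, §3.3.
[cite: ONeillSemiRiemannian1983, Ch. 3, pp. 90–91 and Ch. 5, p. 145] -/
theorem exists_lift_isFutureTimelikeCurveOn
    {gN : LorentzianMetric IN ∞ N} (τN : TimeOrientation gN)
    {gP : LorentzianMetric IP ∞ P} (τP : TimeOrientation gP) {Φ : N → P}
    (hΦ : gN.IsIsometricImmersion gP.toPseudoRiemannianMetric Φ)
    (hτ : τN.PreservesTimeOrientation Φ τP) (hinj : Injective Φ)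
    (hloc : IsLocalDiffeomorph IN IP ∞ Φ)
    {γ : ℝ → P} {s : Set ℝ} (hγ : gP.IsFutureTimelikeCurveOn τP γ s)
    (hγs : ∀ t ∈ s, γ t ∈ range Φ) (hs : s.Nonempty) :
    ∃ δ : ℝ → N, (∀ t ∈ s, Φ (δ t) = γ t) ∧ gN.IsFutureTimelikeCurveOn τN δ s := by
  -- adapted from `LorentzianMetric.exists_lift_isEndlessTimelikeCurve` (TimelikeCurveLift.lean)
  classical
  have hOo : IsOpen (range Φ) := hloc.isOpen_range
  have hcont : ∀ t ∈ s, ContinuousAt γ t := fun t ht ↦ (hγ t ht).1.continuousAt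
  have hΦd : MDifferentiable IN IP Φ := hΦ.1.mdifferentiable (by simp)
  -- the lift
  obtain ⟨t₀, ht₀⟩ := hs
  obtain ⟨n₀, -⟩ := hγs t₀ ht₀
  set δ : ℝ → N := fun t ↦ if h : γ t ∈ range Φ then h.choose else n₀ with hδdef
  have hδ : ∀ t, γ t ∈ range Φ → Φ (δ t) = γ t := fun t h ↦ by
    simp only [hδdef, dif_pos h]
    exact h.choose_spec
  -- locally `δ = e⁻¹ ∘ γ` for a local inverse `e⁻¹` of `Φ`
  have hlocal : ∀ t ∈ s, ∃ e : PartialDiffeomorph IN IP N P ∞,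
      γ t ∈ e.target ∧ δ =ᶠ[𝓝 t] (e.symm ∘ γ) := by
    intro t ht
    obtain ⟨e, hsrc, heq⟩ := hloc (δ t)
    have hΦδ : Φ (δ t) = γ t := hδ t (hγs t ht)
    have htgt : γ t ∈ e.target := by
      rw [← hΦδ, heq hsrc]
      exact e.map_source hsrc
    refine ⟨e, htgt, ?_⟩
    have hnhds : ∀ᶠ t' in 𝓝 t, γ t' ∈ e.target :=
      (hcont t ht).preimage_mem_nhds (e.open_target.mem_nhds htgt)
    filter_upwards [hnhds] with t' ht'
    have hw : e.symm (γ t') ∈ e.source := e.map_target ht'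
    have hΦw : Φ (e.symm (γ t')) = γ t' := by
      rw [heq hw]
      exact e.right_inv ht'
    exact hinj ((hδ t' ⟨_, hΦw⟩).trans hΦw.symm)
  -- differentiability of the lift and `dΦ(δ') = γ'`
  have hvel : ∀ t ∈ s, MDifferentiableAt 𝓘(ℝ, ℝ) IN δ t ∧
      mfderiv IN IP Φ (δ t) (velocity IN δ t) = velocity IP γ t := by
    intro t ht
    obtain ⟨e, htgt, hev⟩ := hlocal t ht
    have hγd : MDifferentiableAt 𝓘(ℝ, ℝ) IP γ t := (hγ t ht).1
    have hes : ContMDiffAt IP IN ∞ e.symm (γ t) :=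
      e.contMDiffOn_invFun.contMDiffAt (e.open_target.mem_nhds htgt)
    have hd : MDifferentiableAt 𝓘(ℝ, ℝ) IN (e.symm ∘ γ) t :=
      (hes.mdifferentiableAt (by simp)).comp t hγd
    have hδd : MDifferentiableAt 𝓘(ℝ, ℝ) IN δ t := hev.mdifferentiableAt_iff.2 hd
    refine ⟨hδd, ?_⟩
    have hev2 : γ =ᶠ[𝓝 t] (Φ ∘ δ) := by
      filter_upwards [(hcont t ht).preimage_mem_nhds (hOo.mem_nhds (hγs t ht))] with t' ht'
      exact (hδ t' ht').symm
    have h1 : mfderiv 𝓘(ℝ, ℝ) IP γ t =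
        (mfderiv IN IP Φ (δ t)).comp (mfderiv 𝓘(ℝ, ℝ) IN δ t) := by
      rw [hev2.mfderiv_eq, mfderiv_comp t (hΦd _) hδd]
    change mfderiv IN IP Φ (δ t) (mfderiv 𝓘(ℝ, ℝ) IN δ t (1 : ℝ)) =
      mfderiv 𝓘(ℝ, ℝ) IP γ t (1 : ℝ)
    rw [h1]
    rfl
  -- the isometry identity
  have key : ∀ (x : N) (u w : TangentSpace IN x),
      gP.val (Φ x) (mfderiv IN IP Φ x u) (mfderiv IN IP Φ x w) = gN.val x u w := fun x u w ↦ by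
    simpa only [pullbackBilin_apply] using congrArg (fun b ↦ b u w) (hΦ.2 x)
  -- `δ` is a future timelike curve of `N` on `s`
  refine ⟨δ, fun t ht ↦ hδ t (hγs t ht), fun t ht ↦ ?_⟩
  obtain ⟨hδd, hv⟩ := hvel t ht
  obtain ⟨-, h1, h2⟩ := hγ t ht
  have hpt : Φ (δ t) = γ t := hδ t (hγs t ht)
  refine ⟨hδd, ?_, ?_⟩
  · change gN.val (δ t) (velocity IN δ t) (velocity IN δ t) < 0
    rw [← key, hv]
    have hgen : ∀ p, p = γ t → gP.val p (velocity IP γ t) (velocity IP γ t) < 0 := by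
      rintro p rfl
      exact h1
    exact hgen _ hpt
  · have hfd : τP.IsFutureDirected (x := Φ (δ t)) (mfderiv IN IP Φ (δ t) (velocity IN δ t)) := by
      rw [hv]
      have hgen : ∀ p, p = γ t → τP.IsFutureDirected (x := p) (velocity IP γ t) := by
        rintro p rfl
        exact h2
      exact hgen _ hpt
    exact hτ.isFutureDirected_of_mfderiv hΦ.2 hfd

/-- `Φ(I⁺(S)) ⊆ I⁺(Φ(S))` for a time-orientation preserving isometric immersion `Φ` (it carries
future timelike curves to future timelike curves: chain rule, isometry, and
`PreservesTimeOrientation.isFutureDirected_mfderiv`). O'Neill 1983, Ch. 14, pp. 402–403.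
[cite: ONeillSemiRiemannian1983, Ch. 14, pp. 402–403] -/
theorem image_chronologicalFuture_subset {n : ℕ∞ω}
    {gN : LorentzianMetric IN n N} {τN : TimeOrientation gN}
    {gP : LorentzianMetric IP n P} {τP : TimeOrientation gP} {Φ : N → P}
    (hΦd : MDifferentiable IN IP Φ) (hτ : τN.PreservesTimeOrientation Φ τP)
    (hΦ : ∀ y, pullbackBilin (I := IP) (I' := IN) Φ gP.val y = gN.val y) (S : Set N) :
    Φ '' gN.chronologicalFuture τN S ⊆ gP.chronologicalFuture τP (Φ '' S) := by
  rintro _ ⟨q, ⟨p, hp, γ, a, b, hab, hγ, hγa, hγb⟩, rfl⟩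
  refine ⟨Φ p, mem_image_of_mem Φ hp, Φ ∘ γ, a, b, hab, fun t ht ↦ ?_, by simp [hγa], by simp [hγb]⟩
  obtain ⟨hd, htl, hfd⟩ := hγ t ht
  refine ⟨(hΦd (γ t)).comp t hd, ?_⟩
  have hvel : velocity IP (Φ ∘ γ) t = mfderiv IN IP Φ (γ t) (velocity IN γ t) := by
    unfold velocity
    rw [mfderiv_comp t (hΦd (γ t)) hd]
    rfl
  have key : ∀ u w : TangentSpace IN (γ t),
      gP.val (Φ (γ t)) (mfderiv IN IP Φ (γ t) u) (mfderiv IN IP Φ (γ t) w) = gN.val (γ t) u w :=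
    fun u w ↦ by simpa only [pullbackBilin_apply] using congrArg (fun b ↦ b u w) (hΦ (γ t))
  rw [hvel]
  refine ⟨?_, hτ.isFutureDirected_mfderiv hΦ hfd⟩
  change gP.val (Φ (γ t)) (mfderiv IN IP Φ (γ t) (velocity IN γ t))
    (mfderiv IN IP Φ (γ t) (velocity IN γ t)) < 0
  rw [key]
  exact htl

/-- `Φ(I⁻(S)) ⊆ I⁻(Φ(S))` for a time-orientation preserving isometric immersion `Φ` (time dual of
`image_chronologicalFuture_subset`, via `PreservesTimeOrientation.reverse`). O'Neill 1983, Ch. 14,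
p. 403. [cite: ONeillSemiRiemannian1983, Ch. 14, p. 403] -/
theorem image_chronologicalPast_subset {n : ℕ∞ω}
    {gN : LorentzianMetric IN n N} {τN : TimeOrientation gN}
    {gP : LorentzianMetric IP n P} {τP : TimeOrientation gP} {Φ : N → P}
    (hΦd : MDifferentiable IN IP Φ) (hτ : τN.PreservesTimeOrientation Φ τP)
    (hΦ : ∀ y, pullbackBilin (I := IP) (I' := IN) Φ gP.val y = gN.val y) (S : Set N) :
    Φ '' gN.chronologicalPast τN S ⊆ gP.chronologicalPast τP (Φ '' S) :=
  image_chronologicalFuture_subset hΦd hτ.reverse hΦ S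

end Lift

/-! ## Transport of the Cauchy property and of the exterior region -/

section Developments

variable {X : Type} [TopologicalSpace X] [ChartedSpace E3 X] [IsManifold (𝓡 3) ∞ X]
  [ConnectedSpace X] {D : InitialDataSet (𝓡 3) X}
  {N : Type} [TopologicalSpace N] [ChartedSpace E3 N] [IsManifold (𝓡 3) ∞ N] [ConnectedSpace N]
  {D' : InitialDataSet (𝓡 3) N}

/-- **`ι X ∩ χ(𝒦)` is a Cauchy hypersurface of the open sub-spacetime `χ(𝒦)` of `𝒟`.** For Cauchy
developments `𝒟` (of a datum on `X`) and `𝒦` (of a datum on `N`) and a time-orientation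
preserving isometric open embedding `χ : 𝒦 → 𝒟` with `χ(ι' N) ⊆ ι X`: an endless timelike curve
`γ'` of `(χ(𝒦), g|, τ|)` lifts along `χ` to a timelike curve `δ` of `𝒦`
(`exists_lift_isFutureTimelikeCurveOn`), endless in `𝒦` (an endpoint `q` of `δ` would make
`χ q ∈ χ(𝒦)` an endpoint of `γ'`), so `δ` meets the Cauchy hypersurface `ι' N` of `𝒦` and `γ'`
meets `χ(ι' N) ⊆ ι X`; it meets `ι X` at most once since `ι X` is a Cauchy hypersurface of `𝒟`
(`IsCauchyHypersurface.eq_of_mem_of_mem_opens`). This is the transport of Sbierski 2016, §2,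
Remark 3 (2) (cf. `CommonDevelopment.isCauchyHypersurface_rangeOpens`) to embeddings over a
sub-datum. [cite: Sbierski2016AHP, §2, Remark 3 (2) and §3.1, Lemma 9] -/
theorem isCauchyHypersurface_restrict_range
    (𝒟 : CauchyDevelopment D) (𝒦 : CauchyDevelopment D') (χ : 𝒦.carrier → 𝒟.carrier)
    (hχo : IsOpenEmbedding χ)
    (hχi : 𝒦.metric.IsIsometricImmersion 𝒟.metric.toPseudoRiemannianMetric χ)
    (hχτ : 𝒦.timeOrientation.PreservesTimeOrientation χ 𝒟.timeOrientation)
    (hsub : χ '' range 𝒦.embed ⊆ range 𝒟.embed) :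
    (𝒟.metric.restrict PseudoRiemannianMetric.contMDiff_restrict_holds
        (⟨range χ, hχo.isOpen_range⟩ : TopologicalSpace.Opens 𝒟.carrier)).IsCauchyHypersurface
      (𝒟.timeOrientation.restrict PseudoRiemannianMetric.contMDiff_restrict_holds
        𝒟.timeOrientation.contMDiff_restrict_holds ⟨range χ, hχo.isOpen_range⟩)
      (Subtype.val ⁻¹' range 𝒟.embed) := by
  intro γ' s hγ'
  obtain ⟨hs, hγt, hγf, hγp⟩ := hγ'
  have hn2 : (2 : ℕ∞ω) ≤ ∞ := WithTop.coe_le_coe.mpr le_top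
  have hκ : 𝒟.metric.IsFutureTimelikeCurveOn 𝒟.timeOrientation (Subtype.val ∘ γ') s :=
    (LorentzianMetric.isFutureTimelikeCurveOn_restrict_iff _ _ _ _ _).1 hγt
  have hloc : IsLocalDiffeomorph (𝓡 4) (𝓡 4) ∞ χ :=
    LorentzianMetric.isLocalDiffeomorph_of_isIsometricImmersion hχi
  -- the lift `δ` of `γ'` to `𝒦`
  obtain ⟨δ, hδ, hδt⟩ := exists_lift_isFutureTimelikeCurveOn 𝒦.timeOrientation 𝒟.timeOrientation
    hχi hχτ hχo.injective hloc hκ (fun t _ ↦ (γ' t).2) hγf.1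
  -- `δ` is endless in `𝒦`
  have hδf : IsFutureEndless δ s := by
    refine ⟨hγf.1, fun q hq ↦ ?_⟩
    have h1 : HasFutureEndpoint (χ ∘ δ) s (χ q) := (hχi.1.continuous.tendsto q).comp hq
    have h2 : HasFutureEndpoint (Subtype.val ∘ γ') s (χ q) := h1.congr fun t ↦ hδ t t.2
    exact hγf.2 ⟨χ q, q, rfl⟩ (hasFutureEndpoint_subtypeVal_comp_iff.1 h2)
  have hδp : IsPastEndless δ s := by
    refine ⟨hγp.1, fun q hq ↦ ?_⟩
    have h1 : HasPastEndpoint (χ ∘ δ) s (χ q) := (hχi.1.continuous.tendsto q).comp hq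
    have h2 : HasPastEndpoint (Subtype.val ∘ γ') s (χ q) := h1.congr fun t ↦ hδ t t.2
    exact hγp.2 ⟨χ q, q, rfl⟩ (hasPastEndpoint_subtypeVal_comp_iff.1 h2)
  -- it meets `ι' N` (exactly once), hence `γ'` meets `ι X`
  obtain ⟨t₀, ⟨ht₀s, ht₀S⟩, -⟩ := 𝒦.isCauchyHypersurface δ s ⟨hs, hδt, hδf, hδp⟩
  have hmem : (γ' t₀).1 ∈ range 𝒟.embed := by
    rw [← show χ (δ t₀) = (γ' t₀).1 from hδ t₀ ht₀s]
    exact hsub ⟨δ t₀, ht₀S, rfl⟩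
  exact ⟨t₀, ⟨ht₀s, hmem⟩, fun t ht ↦
    LorentzianMetric.IsCauchyHypersurface.eq_of_mem_of_mem_opens _ _ hn2 𝒟.isCauchyHypersurface
      hs hγt ht.1 ht₀s ht.2 hmem⟩

/-- **The self-determined exterior region transports along an embedding of a sub-development.**
For Cauchy developments `𝒟`, `𝒦` and a time-orientation preserving isometric open embedding
`χ : 𝒦 → 𝒟` with `χ(ι' N) ⊆ ι X`, and every `C ⊆ 𝒦`:
`J⁺_𝒟(ι X) ∩ I⁻_𝒟(χ C) = χ (J⁺_𝒦(ι' N) ∩ I⁻_𝒦(C))`. `⊇`: `χ` carries causal and timelike curves to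
such (`LorentzianMetric.image_causalFuture_subset`, `image_chronologicalPast_subset`). `⊆`
(exterior ignorance): with `U := χ(𝒦)`, `ι X ∩ U` is a Cauchy hypersurface of `U`
(`isCauchyHypersurface_restrict_range`) and `ι X` is achronal (O'Neill's Lemma 14.29), so no
timelike curve enters `U` from `J⁺(ι X) ∖ U` (`IsAchronal.mem_opens_of_mem_chronologicalFuture`):
a point `p ∈ J⁺(ι X)` with `p ≪ χ c` lies in `U`; the timelike curve from `p` to `χ c` stays in `U`
(`IsCauchyHypersurface.mem_opens_of_isFutureCausalCurveOn`) and lifts to `𝒦`, so `p = χ k` with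
`k ≪ c`; finally `k ∈ J⁺_𝒦(ι' N)`, for otherwise `k ≪ ι' N` in `𝒦`
(`IsCauchyHypersurface.mem_chronologicalFuture_union_chronologicalPast`), whence
`p ∈ I⁻_𝒟(ι X) ∩ J⁺_𝒟(ι X)` and push-up (`mem_chronologicalFuture_of_mem_causalFuture`) yields two
chronologically related points of the achronal set `ι X`. Sbierski 2016, §3.2; O'Neill 1983,
Ch. 14, Cor. 14.1 and Lemma 14.29. [cite: Sbierski2016AHP, §3.2, Lemmas 15–16] -/
theorem exteriorOf_image_eq
    (𝒟 : CauchyDevelopment D) (𝒦 : CauchyDevelopment D') (χ : 𝒦.carrier → 𝒟.carrier)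
    (hχo : IsOpenEmbedding χ)
    (hχi : 𝒦.metric.IsIsometricImmersion 𝒟.metric.toPseudoRiemannianMetric χ)
    (hχτ : 𝒦.timeOrientation.PreservesTimeOrientation χ 𝒟.timeOrientation)
    (hsub : χ '' range 𝒦.embed ⊆ range 𝒟.embed) (C : Set 𝒦.carrier) :
    Summit.FinalStateConjecture.exteriorOf 𝒟 (χ '' C) =
      χ '' Summit.FinalStateConjecture.exteriorOf 𝒦 C := by
  have hn2 : (2 : ℕ∞ω) ≤ ∞ := WithTop.coe_le_coe.mpr le_top
  have hn1 : (1 : ℕ∞ω) ≤ ∞ := le_trans one_le_two hn2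
  have hU := isCauchyHypersurface_restrict_range 𝒟 𝒦 χ hχo hχi hχτ hsub
  have hA : 𝒟.metric.IsAchronal 𝒟.timeOrientation (range 𝒟.embed) :=
    LorentzianMetric.IsCauchyHypersurface.isAchronal_holds hn2 𝒟.isCauchyHypersurface
  have hχd : MDifferentiable (𝓡 4) (𝓡 4) χ := hχi.1.mdifferentiable (by simp)
  have hloc : IsLocalDiffeomorph (𝓡 4) (𝓡 4) ∞ χ :=
    LorentzianMetric.isLocalDiffeomorph_of_isIsometricImmersion hχi
  refine Subset.antisymm ?_ ?_
  · rintro p ⟨hpJ, hpI⟩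
    -- `p ≪ χ c` for some `c ∈ C`
    obtain ⟨q, hqC, hpq⟩ :
        ∃ q ∈ χ '' C, p ∈ 𝒟.metric.chronologicalPast 𝒟.timeOrientation {q} := by
      have h := hpI
      rw [LorentzianMetric.chronologicalPast, LorentzianMetric.chronologicalFuture_eq_biUnion] at h
      simp only [mem_iUnion, exists_prop] at h
      exact h
    obtain ⟨c, hcC, rfl⟩ := hqC
    have hqp : χ c ∈ 𝒟.metric.chronologicalFuture 𝒟.timeOrientation {p} :=
      LorentzianMetric.mem_chronologicalFuture_of_mem_chronologicalPast hpq
    -- no timelike entry: `p ∈ χ(𝒦)`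
    have hpU : p ∈ (⟨range χ, hχo.isOpen_range⟩ : TopologicalSpace.Opens 𝒟.carrier) :=
      hA.mem_opens_of_mem_chronologicalFuture hn2 _ _ hU hpJ (show χ c ∈ range χ from ⟨c, rfl⟩) hqp
    -- the timelike curve from `p` to `χ c` stays in `χ(𝒦)` (causal convexity)
    obtain ⟨p', hp', γ, a, b, hab, hγ, rfl, hγb⟩ := hqp
    have hp'' : γ a = p := hp'
    subst hp''
    have hγU : ∀ t ∈ Icc a b, γ t ∈ range χ := fun t ht ↦
      LorentzianMetric.IsCauchyHypersurface.mem_opens_of_isFutureCausalCurveOn hn2 _ _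
        𝒟.isCauchyHypersurface hU hγ.isFutureCausalCurveOn
        (show γ a ∈ range χ from hpU) (show γ b ∈ range χ from ⟨c, hγb.symm⟩) ht
    -- lift it to `𝒦`
    obtain ⟨δ, hδ, hδt⟩ := exists_lift_isFutureTimelikeCurveOn 𝒦.timeOrientation
      𝒟.timeOrientation hχi hχτ hχo.injective hloc hγ hγU (nonempty_Icc.2 hab.le)
    have hδa : χ (δ a) = γ a := hδ a (left_mem_Icc.2 hab.le)
    have hδb : δ b = c := hχo.injective ((hδ b (right_mem_Icc.2 hab.le)).trans hγb)
    refine ⟨δ a, ⟨?_, ?_⟩, hδa⟩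
    · -- `δ a ∈ J⁺_𝒦(ι' N)`
      by_contra hk
      have hkS : δ a ∉ range 𝒦.embed := fun h ↦
        hk (LorentzianMetric.subset_causalFuture _ _ _ h)
      rcases 𝒦.isCauchyHypersurface.mem_chronologicalFuture_union_chronologicalPast hn2 hkS
        with h | h
      · exact hk (LorentzianMetric.chronologicalFuture_subset_causalFuture _ _ _ h)
      · -- `δ a ≪ ι' N` in `𝒦`: then `p ∈ I⁻_𝒟(ι X) ∩ J⁺_𝒟(ι X)`, contradicting achronality
        have hpI' : γ a ∈ 𝒟.metric.chronologicalPast 𝒟.timeOrientation (range 𝒟.embed) := by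
          have h1 := image_chronologicalPast_subset hχd hχτ hχi.2 (range 𝒦.embed) ⟨δ a, h, hδa⟩
          exact LorentzianMetric.chronologicalFuture_mono hsub h1
        obtain ⟨x₂, hx₂S, hpx₂⟩ :
            ∃ x₂ ∈ range 𝒟.embed, γ a ∈ 𝒟.metric.chronologicalPast 𝒟.timeOrientation {x₂} := by
          rw [LorentzianMetric.chronologicalPast,
            LorentzianMetric.chronologicalFuture_eq_biUnion] at hpI'
          simp only [mem_iUnion, exists_prop] at hpI'
          exact hpI'
        obtain ⟨x₁, hx₁S, hx₁p⟩ :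
            ∃ x₁ ∈ range 𝒟.embed, γ a ∈ 𝒟.metric.causalFuture 𝒟.timeOrientation {x₁} := by
          have h' := hpJ
          rw [LorentzianMetric.causalFuture_eq_biUnion] at h'
          simp only [mem_iUnion, exists_prop] at h'
          exact h'
        exact hA x₁ hx₁S x₂ hx₂S (LorentzianMetric.mem_chronologicalFuture_of_mem_causalFuture hn1
          hx₁p (LorentzianMetric.mem_chronologicalFuture_of_mem_chronologicalPast hpx₂))
    · -- `δ a ∈ I⁻_𝒦(C)`
      have hc : c ∈ 𝒦.metric.chronologicalFuture 𝒦.timeOrientation {δ a} :=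
        ⟨δ a, rfl, δ, a, b, hab, hδt, rfl, hδb⟩
      exact LorentzianMetric.chronologicalFuture_mono (singleton_subset_iff.2 hcC)
        (LorentzianMetric.mem_chronologicalPast_of_mem_chronologicalFuture hc)
  · rintro _ ⟨k, ⟨hkJ, hkI⟩, rfl⟩
    refine ⟨?_, image_chronologicalPast_subset hχd hχτ hχi.2 C ⟨k, hkI, rfl⟩⟩
    exact LorentzianMetric.causalFuture_mono hsub
      (LorentzianMetric.image_causalFuture_subset hχd hχτ hχi.2 (range 𝒦.embed) ⟨k, hkJ, rfl⟩)

end Developments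

/-! ## The registered stub -/

/-- **Stub `stub_exteriorTransport` of line `Sketch` (crux `SwallowTheDatum.UniversalWitnessFamily`),
verbatim the registered signature `Sig.stub_exteriorTransport`.** Let `𝒟` be a Cauchy development
of `D` on `X`, `Φ : N → X` a smooth open embedding with injective differentials, `𝒦` a Cauchy
development of the sub-datum `Φ^* D` which embeds into `𝒟` OVER `Φ` by `χ` (smooth, open
embedding, isometric, time-orientation preserving, `χ ∘ ι' = ι ∘ Φ`). Then for every `C ⊆ 𝒦` the
self-determined exterior regions correspond: `exteriorOf 𝒟 (χ C) = χ (exteriorOf 𝒦 C)`, i.e.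
`J⁺_𝒟(ι X) ∩ I⁻_𝒟(χ C) = χ (J⁺_𝒦(ι' N) ∩ I⁻_𝒦(C))` (`exteriorOf_image_eq` with
`χ(ι' N) = ι(Φ N) ⊆ ι X`). Sbierski 2016, §3.2; Hawking–Ellis 1973, §6.5; O'Neill 1983, Ch. 14,
Cor. 14.1, Lemma 14.29. [cite: Sbierski2016AHP, §3.2] -/
theorem stub_exteriorTransport :
  ∀ (X : Type) [TopologicalSpace X] [ChartedSpace E3 X] [IsManifold (𝓡 3) ∞ X]
    [T2Space X] [SecondCountableTopology X] [ConnectedSpace X]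
    (D : InitialDataSet (𝓡 3) X) (𝒟 : CauchyDevelopment D)
    (N : Type) [TopologicalSpace N] [ChartedSpace E3 N] [IsManifold (𝓡 3) ∞ N] [ConnectedSpace N]
    (Φ : N → X) (hΦ : ContMDiff (𝓡 3) (𝓡 3) (∞ + 1) Φ)
    (hΦ' : ∀ u, Function.Injective (mfderiv (𝓡 3) (𝓡 3) Φ u)),
    Topology.IsOpenEmbedding Φ →
    ∀ (𝒦 : CauchyDevelopment (D.comap Φ hΦ hΦ')) (χ : 𝒦.carrier → 𝒟.carrier),
      ContMDiff (𝓡 4) (𝓡 4) ∞ χ → Topology.IsOpenEmbedding χ →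
      𝒦.metric.IsIsometricImmersion 𝒟.metric.toPseudoRiemannianMetric χ →
      𝒦.timeOrientation.PreservesTimeOrientation χ 𝒟.timeOrientation →
      χ ∘ 𝒦.embed = 𝒟.embed ∘ Φ →
      ∀ C : Set 𝒦.carrier,
        Summit.FinalStateConjecture.exteriorOf 𝒟 (χ '' C) =
          χ '' Summit.FinalStateConjecture.exteriorOf 𝒦 C := by
  intro X _ _ _ _ _ _ D 𝒟 N _ _ _ _ Φ hΦ hΦ' _hΦo 𝒦 χ _hχ hχo hχi hχτ hcomm C
  refine exteriorOf_image_eq 𝒟 𝒦 χ hχo hχi hχτ ?_ C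
  rintro _ ⟨_, ⟨u, rfl⟩, rfl⟩
  exact ⟨Φ u, (congrFun hcomm u).symm⟩

end Summit.FinalStateConjecture.FinalStateConjecture.Theorems.SwallowTheDatum.UniversalWitnessFamily

end
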